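import Summits.QuantumFields.YangMills.Theorems.PoincareLipschitzHistoryTailOfLinearTailDeep

/-!
# Crux `HistoryTailL` (stmt-QuantumFields-19936) — FILE K-19: THE MINIMAL SOCKET «PINNED HEIGHT TAIL»
# (`HistoryTailL` ⟸ per-volume, per-coupling finest-bad-level tails at the CONSTRAINED heights only, all constants AFTER `F`, `γ`, `m`; LEAD seat ym-ust-19936-w1 g11)

Cell `ym3-torus` (YM ladder rung R3 = continuum SU(2) Yang–Mills on T³ — a RUNG, NOT the Clay problem: not d = 4, not infinite volume, not a
mass gap).  Helper `--supports stmt-QuantumFields-19936`; THEOREMS ONLY, def-free.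

WHY (the quantifier audit of the crux, for the planner).  `UnitScaleTilt.HistoryTailL` reads
`∀ L b₁ p₁, ∃ (b₀,p₀) ⪰ (b₁,p₁), ∀ m > 0, ∃ γ₁ > 0, ∀ F γ (F.L = L, 0 < γ ≤ γ₁), HistoryTailAt F γ b₀ p₀ m`, and `HistoryTailAt` asks for a summable
profile `w` chosen AFTER `F` (hence after the volume `(2L^{F.m})³`), after `γ` and after `m`, bounding the Gibbs masses of the complements of
`histGood K ⌊K∕m⌋` ∕ `histGood (K+1) ⌊K∕m⌋` — events that constrain the averaged heights `j ≤ K' − ⌊K∕m⌋` ONLY.  Hence the WEAKEST per-height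
input that still closes the crux is: for every `L`, beyond some profile floors, for every `m`, for small `γ` (threshold after `m`), and THEN for
each family `F` and coupling `γ` separately, constants `C ≥ 0`, `A`, `c > 0` (volume- and coupling-dependent, e.g. `e^{C(L,γ)|T₁|}`) with
`Gibbs_K({θ(K−j) ≤ dist1 Ū^{j}(∂a)} ∩ {∀ i < j, PlaqSmall θ(K−i) Ū^{i}}) ≤ C·β_{K−j}^A·e^{−c·p(g_{K−j})²}` at the heights `1 ≤ j`, `j + 2 ≤ K`,
`j + ⌊(K−1)∕m⌋ ≤ K` — Bałaban's per-block large-field factor `e^{−¼p(g_k)²}` ([Balaban1985UV3] (70)∕(71) p.273) read as a Gibbs probability at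
the constrained scales, with the volume-extensive stability errors `e^{±O(1)|T₁|}` of (41)∕(47) ALLOWED in `C` (they are not allowed in the
registered volume-uniform intermediates `MesoscopicConcentrationL` 23532, (Q) 23133, `MeanDeviationL` 23083).  This file proves that socket:
★★★ `historyTailL_of_pinnedHeightTail (hP) : UnitScaleTilt.HistoryTailL`, and its twin with the WEAKEST (geometric) rate `Cv·(L⁻⁴)^{K−j}`
★★★ `historyTailL_of_geometricHeightTail (hG)` — the registry letter of LINE 31 «PinnedStability» S1 (ideator ym-r3-idea-2 g16, px8 g10), whose
bookkeeping stubs (tower union bound, plaquette count) are thereby already in the tree.  Compared with the landed glue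
✓`fibreConvexityTail_historyTailOfTwoSided_proof` (`TwoSidedTailL ∧ TowerTailL ⇒ HistoryTailL`, per-`(F,γ)` constants already): no conditioner
split, the profile floor may also bound `p₀`, the coupling threshold comes AFTER `m`, and only the constrained heights are asked (K-18b
✓`historyTailAt_of_bare_finestBad_deep`); the quadratic per-height arithmetic is the tree's ✓`exists_perHeight_bound` (any `c > 0`, no `bmin`).
HONEST: route glue (bookkeeping); `hP` is OPEN — it is the d = 3 large-field step for expectations in pinned form, not in print as a probability
statement; nothing of the cruxes, rung R3 or the mass gap is proved here.
References: T. Bałaban, CMP 102 (1985) 255–275 [Balaban1985UV3] ((7) p.257, (41) p.266, (47) p.267, (70)–(71) p.273).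
-/

set_option autoImplicit false

noncomputable section

open MeasureTheory Filter Topology
open Literature.MathematicalPhysics.QuantumFieldTheory.Balaban1983to89
open Literature.MathematicalPhysics.QuantumFieldTheory.Balaban1983to89.Missing
open Literature.MathematicalPhysics.QuantumFieldTheory.Balaban1983to89.T4Continuum
open Literature.MathematicalPhysics.QuantumFieldTheory.Balaban1983to89.T3ContinuumYM3Torus
open Literature.MathematicalPhysics.QuantumFieldTheory.Balaban1983to89.T3UnitScaleTilt
open Literature.MathematicalPhysics.QuantumFieldTheory.Balaban1983to89.T3UnitLawDensityEML (ℰp measurableE_ℰp)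
open Literature.MathematicalPhysics.QuantumFieldTheory.Balaban1983to89.T3BareTailProfile
open Summit.QuantumFields.YangMills.Theorems.HistoryTailOfTwoSided
open Summit.QuantumFields.YangMills.Theorems.PoincareLipschitzHistoryTailOfLinearTail (real_not_plaqSmall_inter_le_sum)
open Summit.QuantumFields.YangMills.Theorems.PoincareLipschitzHistoryTailOfLinearTailDeep (historyTailAt_of_bare_finestBad_deep)

namespace Summit.QuantumFields.YangMills.Theorems.UnitScaleTiltHistoryTailOfPinnedHeightTail

/-- ★★★ **`UnitScaleTilt.HistoryTailL` FROM THE PINNED HEIGHT TAIL — the minimal socket.**  Hypothesis `hP`: for every `L` there are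
profile floors `(b₁', p₁')` such that for every profile `(b₀, p₀)` above them (`0 < b₀`, `2 < p₀`) and every `m > 0` some `γ₁ ∈ (0,1]` gives,
for EACH family `F` with `F.L = L` and EACH `0 < γ ≤ γ₁` SEPARATELY, constants `C ≥ 0`, `A`, `c > 0` with
`Gibbs_K({θ(K−j) ≤ dist1 Ū^{j}(∂a)} ∩ {∀ i < j, PlaqSmall θ(K−i) Ū^{i}}) ≤ C·β_{K−j}^A·e^{−c·p(g_{K−j})²}` at all heights `1 ≤ j`, `j + 2 ≤ K`,
`j + ⌊(K−1)∕m⌋ ≤ K` and all level-`j` plaquettes `a`.  Proof: profile `(max b₁ b₁' 1, max p₁ p₁' 3)`; bare term ✓`bareTailAt`; per height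
the union bound over plaquettes, ✓`card_plaq_le_pow` and ✓`exists_perHeight_bound`; then K-18b's reduction at the constrained heights.
[cite: Balaban1985UV3, (7) p.257 and (70)-(71) p.273] -/
theorem historyTailL_of_pinnedHeightTail
    (hP : ∀ (L : ℕ), ∃ (b₁' p₁' : ℝ), ∀ (b₀ p₀ : ℝ), b₁' ≤ b₀ → p₁' ≤ p₀ → 0 < b₀ → 2 < p₀ → ∀ (m : ℕ), 0 < m →
      ∃ γ₁ : ℝ, 0 < γ₁ ∧ γ₁ ≤ 1 ∧ ∀ (F : T3Family) (γ : ℝ), F.L = L → 0 < γ → γ ≤ γ₁ →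
        ∃ (C c : ℝ) (A : ℕ), 0 ≤ C ∧ 0 < c ∧ ∀ (K j : ℕ), 1 ≤ j → j + 2 ≤ K → j + (K - 1) / m ≤ K → ∀ a : Plaq (F.P K) j,
          (gibbsK F ℰp γ K).real
              ({U : GaugeField (F.P K) 0 (Matrix.specialUnitaryGroup (Fin 2) ℂ) |
                  θBal F.L γ b₀ p₀ (K - j) ≤ GaugeGroup.dist1 (GaugeField.plaqHol
                    (Averaging.iter (fun i' => BlockAveraging.blockAvg (P := F.P K) (j := i') ℰp) j U) a)} ∩
                {U : GaugeField (F.P K) 0 (Matrix.specialUnitaryGroup (Fin 2) ℂ) | ∀ i, i < j →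
                  PlaqSmall (θBal F.L γ b₀ p₀ (K - i))
                    (Averaging.iter (fun i' => BlockAveraging.blockAvg (P := F.P K) (j := i') ℰp) i U)}) ≤
            C * (F.scheme ℰp γ).β (K - j) ^ A *
              Real.exp (-(c * B10.pFun b₀ p₀ (Real.sqrt (γ * ((F.L : ℝ)⁻¹) ^ (K - j))) ^ 2))) :
    Summit.QuantumFields.YangMills.Theses.UnitScaleTilt.HistoryTailL := by
  intro L b₁ p₁
  obtain ⟨b₁', p₁', H⟩ := hP L
  -- the profile above both floors, fixed BEFORE `m`
  obtain ⟨b₀, hb₁, hb₁'', hb₀1⟩ : ∃ b₀ : ℝ, b₁ ≤ b₀ ∧ b₁' ≤ b₀ ∧ 1 ≤ b₀ :=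
    ⟨max b₁ (max b₁' 1), le_max_left _ _, le_max_of_le_right (le_max_left _ _), le_max_of_le_right (le_max_right _ _)⟩
  obtain ⟨p₀, hp₁, hp₁'', hp₀⟩ : ∃ p₀ : ℝ, p₁ ≤ p₀ ∧ p₁' ≤ p₀ ∧ 2 < p₀ :=
    ⟨max p₁ (max p₁' 3), le_max_left _ _, le_max_of_le_right (le_max_left _ _),
      lt_of_lt_of_le (by norm_num) (le_max_of_le_right (le_max_right _ _))⟩
  have hb₀ : 0 < b₀ := one_pos.trans_le hb₀1
  have hp₀1 : 1 ≤ p₀ := by linarith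
  refine ⟨b₀, p₀, hb₁, hp₁, hb₀, hp₀, fun m hm => ?_⟩
  obtain ⟨γ₁, hγ₁, hγ₁1, HF⟩ := H b₀ p₀ hb₁'' hp₁'' hb₀ hp₀ m hm
  refine ⟨γ₁, hγ₁, fun F γ hFL hγ hγle => ?_⟩
  have hγ1 : γ ≤ 1 := hγle.trans hγ₁1
  -- the constants of THIS family and coupling
  obtain ⟨C, c, A, hC, hc, hb⟩ := HF F γ hFL hγ hγle
  -- the bare profile (landed: reflection positivity + chessboard) and the per-height constant (any `c > 0`, no threshold on `b₀`)
  obtain ⟨q₀, hq₀0, hq₀, -, hbare⟩ := bareTailAt F hγ hγ1 hb₀ hp₀1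
  obtain ⟨A', hA'0, hper⟩ := exists_perHeight_bound F hγ hγ1 hb₀ hp₀1 hC A hc
  obtain ⟨hq0, hq, hqt⟩ := geometric_profile hA'0
  refine historyTailAt_of_bare_finestBad_deep F hγ.le b₀ p₀ hm q₀ (fun i => A' * ((1 : ℝ) / 2) ^ i)
    hq₀0 hq₀ hq0 hq hqt hbare fun K j hj1 hjK hjm => ?_
  -- one height: union over plaquettes, the pinned tail, the count, the arithmetic
  haveI := isProbabilityMeasure_gibbsK F ℰp hγ.le K
  refine (real_not_plaqSmall_inter_le_sum (gibbsK F ℰp γ K)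
    (Averaging.iter (fun i' => BlockAveraging.blockAvg (P := F.P K) (j := i') ℰp) j) (θBal F.L γ b₀ p₀ (K - j))
    {U | ∀ i, i < j → PlaqSmall (θBal F.L γ b₀ p₀ (K - i))
      (Averaging.iter (fun i' => BlockAveraging.blockAvg (P := F.P K) (j := i') ℰp) i U)}).trans ?_
  refine (Finset.sum_le_sum fun a _ => hb K j hj1 hjK hjm a).trans ?_
  rw [Finset.sum_const, Finset.card_univ, nsmul_eq_mul]
  have hcard := card_plaq_le_pow F (show j ≤ K by omega)
  have hX : 0 ≤ C * (F.scheme ℰp γ).β (K - j) ^ A *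
      Real.exp (-(c * B10.pFun b₀ p₀ (Real.sqrt (γ * ((F.L : ℝ)⁻¹) ^ (K - j))) ^ 2)) :=
    mul_nonneg (mul_nonneg hC (pow_nonneg (F.scheme_β_nonneg ℰp hγ.le (K - j)) A)) (Real.exp_nonneg _)
  calc (Fintype.card (Plaq (F.P K) j) : ℝ) * (C * (F.scheme ℰp γ).β (K - j) ^ A *
          Real.exp (-(c * B10.pFun b₀ p₀ (Real.sqrt (γ * ((F.L : ℝ)⁻¹) ^ (K - j))) ^ 2)))
      ≤ (9 * (8 * (F.L : ℝ) ^ (3 * F.m) * ((F.L : ℝ) ^ (K - j)) ^ 3)) * (C * (F.scheme ℰp γ).β (K - j) ^ A *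
          Real.exp (-(c * B10.pFun b₀ p₀ (Real.sqrt (γ * ((F.L : ℝ)⁻¹) ^ (K - j))) ^ 2))) :=
        mul_le_mul_of_nonneg_right hcard hX
    _ ≤ A' * ((1 : ℝ) / 2) ^ (K - j) := hper (K - j)

/-- ★★★ **THE SAME SOCKET WITH THE WEAKEST (GEOMETRIC) RATE** — the registry text of LINE 31 «PinnedStability» (ideator ym-r3-idea-2 g16, v0 S1,
px8 g10 GO): per family and coupling a constant `Cv ≥ 0` with `Gibbs_K({θ(K−j) ≤ dist1 Ū^{j}(∂a)} ∩ {∀ i < j, PlaqSmall θ(K−i) Ū^{i}}) ≤ Cv·(L⁻⁴)^{K−j}`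
at the constrained heights.  Composition: `#Plaq_j ≤ 9·8L^{3m}(L^{K−j})³` (✓`card_plaq_le_pow`), so the height-`j` mass is `≤ 72·Cv·L^{3m}·L^{−(K−j)} ≤
A'·2^{−(K−j)}` (`L ≥ 2`); bare term ✓`bareTailAt`; reduction K-18b ✓`historyTailAt_of_bare_finestBad_deep`.  With this theorem the line's
bookkeeping stubs (tower union bound, plaquette count) are ALREADY in the tree: `HistoryTailL` ⟸ S1 alone, by `exact`.
[cite: Balaban1985UV3, (7) p.257 and (70)-(71) p.273] -/
theorem historyTailL_of_geometricHeightTail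
    (hG : ∀ (L : ℕ), ∃ (b₁' p₁' : ℝ), ∀ (b₀ p₀ : ℝ), b₁' ≤ b₀ → p₁' ≤ p₀ → 0 < b₀ → 2 < p₀ → ∀ (m : ℕ), 0 < m →
      ∃ γ₁ : ℝ, 0 < γ₁ ∧ γ₁ ≤ 1 ∧ ∀ (F : T3Family) (γ : ℝ), F.L = L → 0 < γ → γ ≤ γ₁ →
        ∃ Cv : ℝ, 0 ≤ Cv ∧ ∀ (K j : ℕ), 1 ≤ j → j + 2 ≤ K → j + (K - 1) / m ≤ K → ∀ a : Plaq (F.P K) j,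
          (gibbsK F ℰp γ K).real
              ({U : GaugeField (F.P K) 0 (Matrix.specialUnitaryGroup (Fin 2) ℂ) |
                  θBal F.L γ b₀ p₀ (K - j) ≤ GaugeGroup.dist1 (GaugeField.plaqHol
                    (Averaging.iter (fun i' => BlockAveraging.blockAvg (P := F.P K) (j := i') ℰp) j U) a)} ∩
                {U : GaugeField (F.P K) 0 (Matrix.specialUnitaryGroup (Fin 2) ℂ) | ∀ i, i < j →
                  PlaqSmall (θBal F.L γ b₀ p₀ (K - i))
                    (Averaging.iter (fun i' => BlockAveraging.blockAvg (P := F.P K) (j := i') ℰp) i U)}) ≤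
            Cv * (((F.L : ℝ)⁻¹) ^ 4) ^ (K - j)) :
    Summit.QuantumFields.YangMills.Theses.UnitScaleTilt.HistoryTailL := by
  intro L b₁ p₁
  obtain ⟨b₁', p₁', H⟩ := hG L
  obtain ⟨b₀, hb₁, hb₁'', hb₀1⟩ : ∃ b₀ : ℝ, b₁ ≤ b₀ ∧ b₁' ≤ b₀ ∧ 1 ≤ b₀ :=
    ⟨max b₁ (max b₁' 1), le_max_left _ _, le_max_of_le_right (le_max_left _ _), le_max_of_le_right (le_max_right _ _)⟩
  obtain ⟨p₀, hp₁, hp₁'', hp₀⟩ : ∃ p₀ : ℝ, p₁ ≤ p₀ ∧ p₁' ≤ p₀ ∧ 2 < p₀ :=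
    ⟨max p₁ (max p₁' 3), le_max_left _ _, le_max_of_le_right (le_max_left _ _),
      lt_of_lt_of_le (by norm_num) (le_max_of_le_right (le_max_right _ _))⟩
  have hb₀ : 0 < b₀ := one_pos.trans_le hb₀1
  have hp₀1 : 1 ≤ p₀ := by linarith
  refine ⟨b₀, p₀, hb₁, hp₁, hb₀, hp₀, fun m hm => ?_⟩
  obtain ⟨γ₁, hγ₁, hγ₁1, HF⟩ := H b₀ p₀ hb₁'' hp₁'' hb₀ hp₀ m hm
  refine ⟨γ₁, hγ₁, fun F γ hFL hγ hγle => ?_⟩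
  have hγ1 : γ ≤ 1 := hγle.trans hγ₁1
  obtain ⟨Cv, hCv, hb⟩ := HF F γ hFL hγ hγle
  obtain ⟨q₀, hq₀0, hq₀, -, hbare⟩ := bareTailAt F hγ hγ1 hb₀ hp₀1
  -- the geometric per-height constant: `72·Cv·L^{3m}`, ratio `L⁻¹ ≤ 1/2`
  have hL2 : (2 : ℝ) ≤ F.L := by exact_mod_cast F.hL.2
  have hL0 : (0 : ℝ) < F.L := by linarith
  have hLinv : ((F.L : ℝ)⁻¹) ≤ 1 / 2 := by rw [one_div]; exact inv_anti₀ two_pos hL2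
  set A' : ℝ := 72 * Cv * (F.L : ℝ) ^ (3 * F.m) with hA'
  have hA'0 : 0 ≤ A' := by positivity
  obtain ⟨hq0, hq, hqt⟩ := geometric_profile hA'0
  refine historyTailAt_of_bare_finestBad_deep F hγ.le b₀ p₀ hm q₀ (fun i => A' * ((1 : ℝ) / 2) ^ i)
    hq₀0 hq₀ hq0 hq hqt hbare fun K j hj1 hjK hjm => ?_
  haveI := isProbabilityMeasure_gibbsK F ℰp hγ.le K
  refine (real_not_plaqSmall_inter_le_sum (gibbsK F ℰp γ K)
    (Averaging.iter (fun i' => BlockAveraging.blockAvg (P := F.P K) (j := i') ℰp) j) (θBal F.L γ b₀ p₀ (K - j))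
    {U | ∀ i, i < j → PlaqSmall (θBal F.L γ b₀ p₀ (K - i))
      (Averaging.iter (fun i' => BlockAveraging.blockAvg (P := F.P K) (j := i') ℰp) i U)}).trans ?_
  refine (Finset.sum_le_sum fun a _ => hb K j hj1 hjK hjm a).trans ?_
  rw [Finset.sum_const, Finset.card_univ, nsmul_eq_mul]
  have hcard := card_plaq_le_pow F (show j ≤ K by omega)
  have hX : 0 ≤ Cv * (((F.L : ℝ)⁻¹) ^ 4) ^ (K - j) := by positivity
  have hpow : ((F.L : ℝ) ^ (K - j)) ^ 3 * (((F.L : ℝ)⁻¹) ^ 4) ^ (K - j) = ((F.L : ℝ)⁻¹) ^ (K - j) := by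
    have hL0' : (F.L : ℝ) ≠ 0 := hL0.ne'
    have h1 : (((F.L : ℝ)⁻¹) ^ 4) ^ (K - j) = ((F.L : ℝ)⁻¹) ^ ((K - j) * 3) * ((F.L : ℝ)⁻¹) ^ (K - j) := by
      rw [← pow_mul, ← pow_add]; congr 1; ring
    have h2 : ((F.L : ℝ) ^ (K - j)) ^ 3 * ((F.L : ℝ)⁻¹) ^ ((K - j) * 3) = 1 := by
      rw [← pow_mul, ← mul_pow, mul_inv_cancel₀ hL0', one_pow]
    rw [h1, ← mul_assoc, h2, one_mul]
  have hgeo : ((F.L : ℝ)⁻¹) ^ (K - j) ≤ ((1 : ℝ) / 2) ^ (K - j) :=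
    pow_le_pow_left₀ (inv_nonneg.mpr hL0.le) hLinv _
  calc (Fintype.card (Plaq (F.P K) j) : ℝ) * (Cv * (((F.L : ℝ)⁻¹) ^ 4) ^ (K - j))
      ≤ (9 * (8 * (F.L : ℝ) ^ (3 * F.m) * ((F.L : ℝ) ^ (K - j)) ^ 3)) * (Cv * (((F.L : ℝ)⁻¹) ^ 4) ^ (K - j)) :=
        mul_le_mul_of_nonneg_right hcard hX
    _ = A' * (((F.L : ℝ) ^ (K - j)) ^ 3 * (((F.L : ℝ)⁻¹) ^ 4) ^ (K - j)) := by rw [hA']; ring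
    _ = A' * ((F.L : ℝ)⁻¹) ^ (K - j) := by rw [hpow]
    _ ≤ A' * ((1 : ℝ) / 2) ^ (K - j) := mul_le_mul_of_nonneg_left hgeo hA'0

end Summit.QuantumFields.YangMills.Theorems.UnitScaleTiltHistoryTailOfPinnedHeightTail

end
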